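import Mathlib
import HarnessLib
import Summits.HubbardSuperconductivity.HubbardSuperconductivity.Theorems.KLProgrammeKLRegimeEnginePairLadderV9
import Summits.HubbardSuperconductivity.HubbardSuperconductivity.Theorems.KLProgrammeKLRegimeEngineLadderIncrement

/-!
# Route `KLProgramme` — crux K3, ENGINE child gen 5 (stmt-HubbardSuperconductivity-19918 `KLRegimeEngineV14`), stub `stub_engine_step_values`,
# conjunct (E2-v9) at `1 ≤ n`: COMPOSED-MAP REMAINDER PROPAGATION «Wick tower ⇒ plain pair-ladder step» — `pairLadderStepAtV9_of_wickTower`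

Cell gate-hubbard-kl, seat hubbard-kl-k3c1-p1 (g5), technique «composed-map remainder propagation».  Plan g12 (R9) keeps the PLAIN value carriers in
the gen-5 engine slot (option (C), or (A) at the registrant's discretion): the (E2) prover runs a private Wick-ordered tower (p1 g8,
`HOME/p1/StubEngineWickInvariant.draft.lean`, E2-STRUCTURE-NOTE §5) and must COMPOSE three diagonal-weight resolvent relations into the plain clause
`PairLadderStepAtV9 … n` — the step p1's draft assigns to this seat («w := z^W_n + μ_{n−1} − μ_n, N from the three inverse witnesses»).  This file is
that composition, as exact matrix algebra plus two kernel perturbations; nothing about the model is asserted.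

* §1 (generic finite carrier, right-inverse hypotheses only, no smallness): `kltc_inverse_map` — from `(1 − D·X)·N′ = 1` the array `A := X·N′`
  (the plain array, resummed back) satisfies `(1 + D·A)·(1 − D·X) = 1` and `A·(1 − D·X) = X`, i.e. `F_{−μ}⁻¹ = F_{μ}` EXACTLY; `kltc_invert_compose` —
  with a second resummation `(1 + D_w·X)·N = 1`: `X·N = A·N₂`, `(1 + (D_μ + D_w)·A)·N₂ = 1` (`klli_compose`); `kltc_mul_rightInv_apply_eq_zero` —
  ball-restricted arrays stay ball-restricted under resummation (push-through, `klli_pushThrough`).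
* §2 (generic, Neumann regime): **`kltc_tower_compose`** — three relations `C₀ ≈ X·N′` [(1 − D_{μ′}X)N′ = 1, error `E′`], `Y ≈ X·N` [(1 + D_{w₁}X)N = 1,
  error `E_a`], `C₁ ≈ Y·N″` [(1 − D_μ Y)N″ = 1, error `E″`] give `C₁ ≈ C₀·N₃` with `(1 + diag(w₁ + μ′ − μ)·C₀)·N₃ = 1` (two-sided) and the ENTRYWISE
  error `E″ + FT_μ(E₁)`, `E₁ ≥ E_a + FT_{w₁+μ′}(E′)`, where `FT_v(E)(x,y) = E(x,y) + (3/2)m·Σ_b E(x,b)ρ_b + (3/2)m′·Σ_a ρ_a E(a,y) + (9/4)m′m·ΣΣ ρ E ρ`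
  is the weighted four-term form of `klell_kernel_perturbation` (p463012) with majorant weight profiles `ρ ≥ |v|` — feedable with the angular mass
  of the weights (E2-DRIVE §7), unlike any sup form.  Smallness: `(m + e′)·Σρ ≤ 1/3`, `((3/2)m + e₁)·Σσ ≤ 1/3` (one step, three masses `≲ bhi`;
  the package's `klEng_pair_smallness3` is generic in the mass number).
* §3 (model, BY NAME on `…SplitEngineV9`): **`pairLadderStepAtV9_of_wickTower`** — per pair class, the tower data (W-c)_{n−1}, (W-a)_n, (W-c)_n
  of p1's draft with ball-restricted intermediate arrays `X = 𝒞̂^W_{n−1}(Qm)`, `Y = 𝒞̂^W_n(Qm)` (ANY matrices vanishing off `klBall²`), real weights,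
  errors bounded on `klBall²` only, the two mass clauses of the COMPOSITE weight `w₁ + μ′ − μ` (it is the plain full rung; its masses are the
  caller's, not a triangle inequality) and ONE closed-form budget inequality at the external entries ⟹ `PairLadderStepAtV9 … n` (`1 ≤ n`).
0 kit.
-/

noncomputable section

namespace Summit.HubbardSuperconductivity.HubbardSuperconductivity.Theorems.KLRegimeSplit

set_option linter.dupNamespace false -- summit = problem name (single-conjunct summit), D-0017

open Finset Matrix Literature.MathematicalPhysics.QuantumLattice Literature.Probability.LatticeModels
open Summit.HubbardSuperconductivity.HubbardSuperconductivity.Theorems.KLProgrammeCooperResummation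
open Summit.HubbardSuperconductivity.HubbardSuperconductivity.Theorems.KLProgrammeLegKernels

/-! ## §1 Exact algebra: inverting a resummation, composing, restriction to the ball -/

section Algebra

variable {ι : Type*} [Fintype ι] [DecidableEq ι]

/-- **Inverse map (exact).**  From a right inverse `N′` of `1 − D·X`, the resummed-back array `A := X·N′` satisfies `(1 + D·A)·(1 − D·X) = 1` and
`A·(1 − D·X) = X`: resumming `A` with the weights `+D` returns `X` (`F_{−μ}⁻¹ = F_{μ}`), with the explicit right inverse `1 − D·X`. -/
theorem kltc_inverse_map (X D N' : Matrix ι ι ℂ) (hN' : (1 - D * X) * N' = 1) :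
    (1 + D * (X * N')) * (1 - D * X) = 1 ∧ X * N' * (1 - D * X) = X := by
  have hN'c : N' * (1 - D * X) = 1 := mul_eq_one_comm.mp hN'
  constructor
  · calc (1 + D * (X * N')) * (1 - D * X) = (1 - D * X) + D * X * (N' * (1 - D * X)) := by noncomm_ring
      _ = 1 := by rw [hN'c]; noncomm_ring
  · calc X * N' * (1 - D * X) = X * (N' * (1 - D * X)) := by rw [mul_assoc]
      _ = X := by rw [hN'c, mul_one]

/-- **Invert-and-compose (exact).**  With `(1 − D_μ·X)·N′ = 1` and `(1 + D_w·X)·N = 1`: the one-step resummation `X·N` of `X` equals the resummation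
of `A := X·N′` with the COMBINED weights `D_μ + D_w`, `X·N = A·N₂`, `(1 + (D_μ + D_w)·A)·N₂ = 1`, `N₂ := (1 − D_μ·X)·N` (`klli_compose`). -/
theorem kltc_invert_compose (X Dμ Dw N' N : Matrix ι ι ℂ) (hN' : (1 - Dμ * X) * N' = 1) (hN : (1 + Dw * X) * N = 1) :
    (1 + (Dμ + Dw) * (X * N')) * ((1 - Dμ * X) * N) = 1 ∧ X * N' * ((1 - Dμ * X) * N) = X * N := by
  obtain ⟨h1, h2⟩ := kltc_inverse_map X Dμ N' hN'
  constructor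
  · refine klli_compose (X * N') Dμ Dw (1 - Dμ * X) N h1 ?_
    rw [h2]; exact hN
  · rw [← mul_assoc, h2]

/-- **Ball-restricted arrays stay ball-restricted under resummation.**  If `X` vanishes off `B × B` and `(1 + D·X)·N = 1`, then `X·N` vanishes off
`B × B` (rows: directly; columns: by the push-through form `X·N = (1 − X·N·D)·X`, `klli_pushThrough`). -/
theorem kltc_mul_rightInv_apply_eq_zero (X D N : Matrix ι ι ℂ) (B : Finset ι) (hN : (1 + D * X) * N = 1)
    (hX : ∀ x y, ¬(x ∈ B ∧ y ∈ B) → X x y = 0) {x y : ι} (hxy : ¬(x ∈ B ∧ y ∈ B)) : (X * N) x y = 0 := by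
  by_cases hx : x ∈ B
  · have hy : y ∉ B := fun hy => hxy ⟨hx, hy⟩
    rw [klli_pushThrough X D N hN, Matrix.mul_apply]
    exact Finset.sum_eq_zero fun a _ => by rw [hX a y (fun h => hy h.2), mul_zero]
  · rw [Matrix.mul_apply]
    exact Finset.sum_eq_zero fun a _ => by rw [hX x a (fun h => hx h.1), zero_mul]

end Algebra

/-! ## §2 The composition with remainders (Neumann regime, weighted four-term propagation) -/

section Compose

variable {S : Type*} [Fintype S] [DecidableEq S] [Nonempty S]

/-- **Composed-map remainder propagation through a three-relation tower.**  Arrays `C₀` (plain, scale `n−1`, `|C₀| ≤ m`), `X`, `Y`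
(intermediate — the Wick arrays of scales `n−1`, `n`), `C₁` (plain, scale `n`); complex weights `μ′`, `w₁`, `μ` with majorant profiles
`ρ ≥ |w₁ + μ′|`, `σ ≥ |μ|`; right inverses `N′` of `1 − diag μ′·X`, `N` of `1 + diag w₁·X`, `N″` of `1 − diag μ·Y`; entrywise error majorants
`‖C₀ − X·N′‖ ≤ E′ ≤ e′`, `‖Y − X·N‖ ≤ E_a`, `‖C₁ − Y·N″‖ ≤ E″`, and an intermediate majorant `E₁ ≥ E_a + FT_{ρ}(E′)` with `E₁ ≤ e₁`; smallness
`(m + e′)·Σρ ≤ 1/3`, `((3/2)m + e₁)·Σσ ≤ 1/3`.  THEN `1 + diag(w₁ + μ′ − μ)·C₀` has a two-sided inverse `N₃` and, entrywise,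
`‖C₁ − C₀·N₃‖(x,y) ≤ E″(x,y) + E₁(x,y) + (3/2)(3/2 m)·Σ_b E₁(x,b)σ_b + (3/2)((3/2)m + e₁)·Σ_a σ_a E₁(a,y) + (9/4)((3/2)m + e₁)(3/2 m)·Σ_aΣ_b σ_a E₁(a,b) σ_b`.
(Exact steps: `X = F_{μ′}(C₀ − err′)` by `kltc_inverse_map`; `X·N = F_{w₁+μ′}(C₀ − err′)` by `kltc_invert_compose`; two applications of
`klell_kernel_perturbation`; `klli_compose` for `F_{−μ} ∘ F_{w₁+μ′} = F_{w₁+μ′−μ}`.) -/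
theorem kltc_tower_compose (C₀ C₁ X Y N' N N'' : Matrix S S ℂ) (μ' w₁ μ : S → ℂ) (ρ σ : S → ℝ) (E' Ea E'' E₁ : S → S → ℝ)
    {m e' e₁ : ℝ} (hm : 0 ≤ m) (he' : 0 ≤ e') (he₁ : 0 ≤ e₁)
    (hC₀ : ∀ x y, ‖C₀ x y‖ ≤ m) (hρ : ∀ a, ‖w₁ a + μ' a‖ ≤ ρ a) (hσ : ∀ a, ‖μ a‖ ≤ σ a)
    (hN' : (1 - diagonal μ' * X) * N' = 1) (hE' : ∀ x y, ‖C₀ x y - (X * N') x y‖ ≤ E' x y) (hE'e : ∀ x y, E' x y ≤ e')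
    (hN : (1 + diagonal w₁ * X) * N = 1) (hEa : ∀ x y, ‖Y x y - (X * N) x y‖ ≤ Ea x y)
    (hN'' : (1 - diagonal μ * Y) * N'' = 1) (hE'' : ∀ x y, ‖C₁ x y - (Y * N'') x y‖ ≤ E'' x y)
    (hE₁ : ∀ x y, Ea x y + (E' x y + 3 / 2 * m * ∑ b, E' x b * ρ b + 3 / 2 * (m + e') * ∑ a, ρ a * E' a y +
        9 / 4 * (m + e') * m * ∑ a, ∑ b, ρ a * E' a b * ρ b) ≤ E₁ x y)
    (hE₁e : ∀ x y, E₁ x y ≤ e₁)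
    (hsm₁ : (m + e') * ∑ a, ρ a ≤ 1 / 3) (hsm₂ : (3 / 2 * m + e₁) * ∑ a, σ a ≤ 1 / 3) :
    ∃ N₃ : Matrix S S ℂ, (1 + diagonal (fun a => w₁ a + μ' a - μ a) * C₀) * N₃ = 1 ∧
      N₃ * (1 + diagonal (fun a => w₁ a + μ' a - μ a) * C₀) = 1 ∧
      ∀ x y, ‖C₁ x y - (C₀ * N₃) x y‖ ≤ E'' x y + (E₁ x y + 3 / 2 * (3 / 2 * m) * ∑ b, E₁ x b * σ b +
        3 / 2 * (3 / 2 * m + e₁) * ∑ a, σ a * E₁ a y + 9 / 4 * (3 / 2 * m + e₁) * (3 / 2 * m) * ∑ a, ∑ b, σ a * E₁ a b * σ b) := by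
  -- nonnegativity bookkeeping
  have hE'0 : ∀ x y, 0 ≤ E' x y := fun x y => (norm_nonneg _).trans (hE' x y)
  have hEa0 : ∀ x y, 0 ≤ Ea x y := fun x y => (norm_nonneg _).trans (hEa x y)
  have hρ0 : ∀ a, 0 ≤ ρ a := fun a => (norm_nonneg _).trans (hρ a)
  have hσ0 : ∀ a, 0 ≤ σ a := fun a => (norm_nonneg _).trans (hσ a)
  have hme' : 0 ≤ m + e' := add_nonneg hm he'
  have hE₁0 : ∀ x y, 0 ≤ E₁ x y := by
    intro x y
    refine le_trans ?_ (hE₁ x y)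
    have h1 : 0 ≤ ∑ b, E' x b * ρ b := sum_nonneg fun b _ => mul_nonneg (hE'0 x b) (hρ0 b)
    have h2 : 0 ≤ ∑ a, ρ a * E' a y := sum_nonneg fun a _ => mul_nonneg (hρ0 a) (hE'0 a y)
    have h3 : 0 ≤ ∑ a, ∑ b, ρ a * E' a b * ρ b :=
      sum_nonneg fun a _ => sum_nonneg fun b _ => mul_nonneg (mul_nonneg (hρ0 a) (hE'0 a b)) (hρ0 b)
    have := hEa0 x y; have := hE'0 x y
    positivity
  -- the combined weights of the first two maps
  set v : S → ℂ := fun a => w₁ a + μ' a with hv_def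
  have hZv_le : ∑ a, ‖v a‖ ≤ ∑ a, ρ a := sum_le_sum fun a _ => hρ a
  have hZv0 : 0 ≤ ∑ a, ‖v a‖ := sum_nonneg fun a _ => norm_nonneg _
  have hZvK : (m + e') * ∑ a, ‖v a‖ ≤ 1 / 3 := (mul_le_mul_of_nonneg_left hZv_le hme').trans hsm₁
  have hZvC : m * ∑ a, ‖v a‖ ≤ 1 / 3 :=
    (mul_le_mul_of_nonneg_right (by linarith : m ≤ m + e') hZv0).trans hZvK
  -- Step 1 (exact): `X·N = A·N₂`, `A := X·N′`, `(1 + diag v·A)·N₂ = 1`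
  obtain ⟨hN₂, hXN⟩ := kltc_invert_compose X (diagonal μ') (diagonal w₁) N' N hN' hN
  have hdv : diagonal μ' + diagonal w₁ = diagonal v := by
    rw [diagonal_add]; exact congrArg diagonal (funext fun a => add_comm _ _)
  rw [hdv] at hN₂
  set A : Matrix S S ℂ := X * N' with hA_def
  set N₂ : Matrix S S ℂ := (1 - diagonal μ' * X) * N with hN₂_def
  -- entry bound of `A`
  have hA : ∀ x y, ‖A x y‖ ≤ m + e' := by
    intro x y
    have h1 : ‖A x y‖ ≤ ‖C₀ x y‖ + ‖C₀ x y - A x y‖ := by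
      calc ‖A x y‖ = ‖C₀ x y - (C₀ x y - A x y)‖ := by rw [sub_sub_cancel]
        _ ≤ ‖C₀ x y‖ + ‖C₀ x y - A x y‖ := norm_sub_le _ _
    linarith [hC₀ x y, hE' x y, hE'e x y]
  -- Step 2: resum `C₀` at `v` and compare with `A` resummed at `v`
  obtain ⟨N₃, _, hN₃1, -, -, -, -, -, -, hC₀N₃, -, -⟩ := klcrs_single_slice v hm C₀ hC₀ hZvC
  have hTA := (klcrs_single_slice_ladder_hasSum v hme' A hA hZvK N₂ hN₂).2
  have hTC₀ := (klcrs_single_slice_ladder_hasSum v hm C₀ hC₀ hZvC N₃ hN₃1).2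
  have hstep2 : ∀ x y, ‖(X * N) x y - (C₀ * N₃) x y‖ ≤ E' x y + 3 / 2 * m * ∑ b, E' x b * ρ b +
      3 / 2 * (m + e') * ∑ a, ρ a * E' a y + 9 / 4 * (m + e') * m * ∑ a, ∑ b, ρ a * E' a b * ρ b := by
    intro x y
    have h := klell_kernel_perturbation A C₀ v hm hme' hC₀ hA hZvC hZvK (A * N₂) (C₀ * N₃) hTA hTC₀ x y
    rw [← hXN]
    have hEnt : ∀ a b, ‖(A - C₀) a b‖ ≤ E' a b := by
      intro a b; rw [Matrix.sub_apply, norm_sub_rev]; exact hE' a b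
    have h2 : ∑ b, ‖(A - C₀) x b‖ * ‖v b‖ ≤ ∑ b, E' x b * ρ b :=
      sum_le_sum fun b _ => mul_le_mul (hEnt x b) (hρ b) (norm_nonneg _) (hE'0 x b)
    have h3 : ∑ a, ‖v a‖ * ‖(A - C₀) a y‖ ≤ ∑ a, ρ a * E' a y :=
      sum_le_sum fun a _ => mul_le_mul (hρ a) (hEnt a y) (norm_nonneg _) (hρ0 a)
    have h4 : ∑ a, ∑ b, ‖v a‖ * ‖(A - C₀) a b‖ * ‖v b‖ ≤ ∑ a, ∑ b, ρ a * E' a b * ρ b :=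
      sum_le_sum fun a _ => sum_le_sum fun b _ =>
        mul_le_mul (mul_le_mul (hρ a) (hEnt a b) (norm_nonneg _) (hρ0 a)) (hρ b) (norm_nonneg _)
          (mul_nonneg (hρ0 a) (hE'0 a b))
    have e2 : 3 / 2 * m * ∑ b, ‖(A - C₀) x b‖ * ‖v b‖ ≤ 3 / 2 * m * ∑ b, E' x b * ρ b :=
      mul_le_mul_of_nonneg_left h2 (by positivity)
    have e3 : 3 / 2 * (m + e') * ∑ a, ‖v a‖ * ‖(A - C₀) a y‖ ≤ 3 / 2 * (m + e') * ∑ a, ρ a * E' a y :=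
      mul_le_mul_of_nonneg_left h3 (by positivity)
    have e4 : 9 / 4 * (m + e') * m * ∑ a, ∑ b, ‖v a‖ * ‖(A - C₀) a b‖ * ‖v b‖ ≤
        9 / 4 * (m + e') * m * ∑ a, ∑ b, ρ a * E' a b * ρ b := mul_le_mul_of_nonneg_left h4 (by positivity)
    linarith [hEnt x y]
  -- hence `Y = C₀·N₃ + Δ₁`, `‖Δ₁‖ ≤ E₁`
  set Y₀ : Matrix S S ℂ := C₀ * N₃ with hY₀_def
  have hYY₀ : ∀ x y, ‖(Y - Y₀) x y‖ ≤ E₁ x y := by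
    intro x y
    rw [Matrix.sub_apply]
    have h1 : ‖Y x y - Y₀ x y‖ ≤ ‖Y x y - (X * N) x y‖ + ‖(X * N) x y - Y₀ x y‖ := by
      calc ‖Y x y - Y₀ x y‖ = ‖(Y x y - (X * N) x y) + ((X * N) x y - Y₀ x y)‖ := by rw [sub_add_sub_cancel]
        _ ≤ ‖Y x y - (X * N) x y‖ + ‖(X * N) x y - Y₀ x y‖ := norm_add_le _ _
    linarith [hEa x y, hstep2 x y, hE₁ x y]
  -- entry bounds of `Y₀`, `Y`
  have hm₀ : 0 ≤ 3 / 2 * m := by positivity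
  have hmY : 0 ≤ 3 / 2 * m + e₁ := by positivity
  have hY₀b : ∀ x y, ‖Y₀ x y‖ ≤ 3 / 2 * m := hC₀N₃
  have hYb : ∀ x y, ‖Y x y‖ ≤ 3 / 2 * m + e₁ := by
    intro x y
    have h1 : ‖Y x y‖ ≤ ‖Y₀ x y‖ + ‖(Y - Y₀) x y‖ := by
      calc ‖Y x y‖ = ‖Y₀ x y + (Y - Y₀) x y‖ := by rw [Matrix.sub_apply, add_sub_cancel]
        _ ≤ ‖Y₀ x y‖ + ‖(Y - Y₀) x y‖ := norm_add_le _ _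
    linarith [hY₀b x y, hYY₀ x y, hE₁e x y]
  -- the weights `−μ` of the last map
  set ν : S → ℂ := fun a => -μ a with hν_def
  have hνn : ∀ a, ‖ν a‖ = ‖μ a‖ := fun a => by rw [hν_def, norm_neg]
  have hZν_le : ∑ a, ‖ν a‖ ≤ ∑ a, σ a := sum_le_sum fun a _ => (hνn a).le.trans (hσ a)
  have hZν0 : 0 ≤ ∑ a, ‖ν a‖ := sum_nonneg fun a _ => norm_nonneg _
  have hZνK : (3 / 2 * m + e₁) * ∑ a, ‖ν a‖ ≤ 1 / 3 := (mul_le_mul_of_nonneg_left hZν_le hmY).trans hsm₂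
  have hZνC : 3 / 2 * m * ∑ a, ‖ν a‖ ≤ 1 / 3 :=
    (mul_le_mul_of_nonneg_right (by linarith : 3 / 2 * m ≤ 3 / 2 * m + e₁) hZν0).trans hZνK
  have hdν : diagonal ν = -diagonal μ := (diagonal_neg μ).symm
  have hN''ν : (1 + diagonal ν * Y) * N'' = 1 := by
    rw [hdν, neg_mul, ← sub_eq_add_neg]; exact hN''
  -- Step 3: resum `Y₀` at `−μ` and compare with `Y` resummed at `−μ`
  obtain ⟨N₄, _, hN₄1, -, -, -, -, -, -, -, -, -⟩ := klcrs_single_slice ν hm₀ Y₀ hY₀b hZνC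
  have hTY := (klcrs_single_slice_ladder_hasSum ν hmY Y hYb hZνK N'' hN''ν).2
  have hTY₀ := (klcrs_single_slice_ladder_hasSum ν hm₀ Y₀ hY₀b hZνC N₄ hN₄1).2
  have hstep3 : ∀ x y, ‖(Y * N'') x y - (Y₀ * N₄) x y‖ ≤ E₁ x y + 3 / 2 * (3 / 2 * m) * ∑ b, E₁ x b * σ b +
      3 / 2 * (3 / 2 * m + e₁) * ∑ a, σ a * E₁ a y +
        9 / 4 * (3 / 2 * m + e₁) * (3 / 2 * m) * ∑ a, ∑ b, σ a * E₁ a b * σ b := by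
    intro x y
    have h := klell_kernel_perturbation Y Y₀ ν hm₀ hmY hY₀b hYb hZνC hZνK (Y * N'') (Y₀ * N₄) hTY hTY₀ x y
    have hσ' : ∀ a, ‖ν a‖ ≤ σ a := fun a => (hνn a).le.trans (hσ a)
    have h2 : ∑ b, ‖(Y - Y₀) x b‖ * ‖ν b‖ ≤ ∑ b, E₁ x b * σ b :=
      sum_le_sum fun b _ => mul_le_mul (hYY₀ x b) (hσ' b) (norm_nonneg _) (hE₁0 x b)
    have h3 : ∑ a, ‖ν a‖ * ‖(Y - Y₀) a y‖ ≤ ∑ a, σ a * E₁ a y :=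
      sum_le_sum fun a _ => mul_le_mul (hσ' a) (hYY₀ a y) (norm_nonneg _) (hσ0 a)
    have h4 : ∑ a, ∑ b, ‖ν a‖ * ‖(Y - Y₀) a b‖ * ‖ν b‖ ≤ ∑ a, ∑ b, σ a * E₁ a b * σ b :=
      sum_le_sum fun a _ => sum_le_sum fun b _ =>
        mul_le_mul (mul_le_mul (hσ' a) (hYY₀ a b) (norm_nonneg _) (hσ0 a)) (hσ' b) (norm_nonneg _)
          (mul_nonneg (hσ0 a) (hE₁0 a b))
    have e2 : 3 / 2 * (3 / 2 * m) * ∑ b, ‖(Y - Y₀) x b‖ * ‖ν b‖ ≤ 3 / 2 * (3 / 2 * m) * ∑ b, E₁ x b * σ b :=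
      mul_le_mul_of_nonneg_left h2 (by positivity)
    have e3 : 3 / 2 * (3 / 2 * m + e₁) * ∑ a, ‖ν a‖ * ‖(Y - Y₀) a y‖ ≤ 3 / 2 * (3 / 2 * m + e₁) * ∑ a, σ a * E₁ a y :=
      mul_le_mul_of_nonneg_left h3 (by positivity)
    have e4 : 9 / 4 * (3 / 2 * m + e₁) * (3 / 2 * m) * ∑ a, ∑ b, ‖ν a‖ * ‖(Y - Y₀) a b‖ * ‖ν b‖ ≤
        9 / 4 * (3 / 2 * m + e₁) * (3 / 2 * m) * ∑ a, ∑ b, σ a * E₁ a b * σ b :=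
      mul_le_mul_of_nonneg_left h4 (by positivity)
    linarith [hYY₀ x y]
  -- Step 4: compose the two resummations of `C₀`
  have hN₃₄ : (1 + (diagonal v + diagonal ν) * C₀) * (N₃ * N₄) = 1 := klli_compose C₀ (diagonal v) (diagonal ν) N₃ N₄ hN₃1 hN₄1
  have hdw : diagonal v + diagonal ν = diagonal (fun a => w₁ a + μ' a - μ a) := by
    rw [diagonal_add]; exact congrArg diagonal (funext fun a => (sub_eq_add_neg _ _).symm)
  rw [hdw] at hN₃₄
  refine ⟨N₃ * N₄, hN₃₄, mul_eq_one_comm.mp hN₃₄, fun x y => ?_⟩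
  have hsplit : C₁ x y - (C₀ * (N₃ * N₄)) x y = (C₁ x y - (Y * N'') x y) + ((Y * N'') x y - (Y₀ * N₄) x y) := by
    rw [hY₀_def, Matrix.mul_assoc, sub_add_sub_cancel]
  rw [hsplit]
  exact (norm_add_le _ _).trans (add_le_add (hE'' x y) (hstep3 x y))

end Compose

/-! ## §3 Model: (E2-v9) at `1 ≤ n` from the Wick tower, BY NAME -/

section Model

variable (L M : ℕ) [NeZero L] [NeZero M]

/-- **(E2-v9) `PairLadderStepAtV9 … n` (`1 ≤ n`) from the private Wick tower** (plan g12 (R9) option (C)/(A); p1 g8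
`StubEngineWickInvariant.draft` (W-a)/(W-c)).  Per pair class `Qm` at scale `n` the caller supplies: ball-restricted intermediate arrays `X`
(`= 𝒞̂^W_{n−1}(Qm)`) and `Y` (`= 𝒞̂^W_n(Qm)`) — any matrices vanishing off `klBall²`; REAL weights `μ′` (straddle, scale `n−1`), `w₁` (Wick step `n`),
`μ` (straddle, scale `n`) with right inverses `N′` of `1 − diag μ′·X`, `N` of `1 + diag w₁·X`, `N″` of `1 − diag μ·Y`; nonnegative error majorants
with `‖𝒞_{n−1} − X·N′‖ ≤ E′ ≤ e′`, `‖Y − X·N‖ ≤ E_a`, `‖𝒞_n − Y·N″‖ ≤ E″` on `klBall²`; an intermediate majorant `E₁ ≥ E_a + FT_{|w₁+μ′|}(E′)`,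
`E₁ ≤ e₁`; one-step smallness `(m + e′)·Σ|w₁ + μ′| ≤ 1/3`, `((3/2)m + e₁)·Σ|μ| ≤ 1/3` (`m` any entry bound of `𝒞̂_{n−1}`, e.g. `2|U| + DU²` from
`klpli_pairArray_entry_le`); the two mass clauses of the COMPOSITE weight `w := w₁ + μ′ − μ` (the plain full rung); and the closed-form budget
inequality `E″ + FT_{|μ|}(E₁) ≤ drivePBar + eremBar + thermalBar + legDressBarQ·countT + (X)` at the external entries.  Then (E2-v9) holds at `n`
with that `w` and `N := N₃` of `kltc_tower_compose`. -/
theorem pairLadderStepAtV9_of_wickTower {G : GeoConsts} {P : SplitConsts} {Q : EngConsts} {β U μ : ℝ} {K₀ : TrigPolyC4v} {n : ℕ}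
    {m : ℝ} (hn : 1 ≤ n) (hm : 0 ≤ m) (hC₀ : ∀ Qm s t, ‖klPairArray L M β U μ K₀ (n - 1) Qm s t‖ ≤ m)
    (htower : ∀ Qm : TorusSite 2 L, IsPairClassAt L Qm n →
      ∃ (X Y N' N N'' : Matrix (TorusSite 2 L) (TorusSite 2 L) ℂ) (μ' w₁ μw : TorusSite 2 L → ℝ)
        (E' Ea E'' E₁ : TorusSite 2 L → TorusSite 2 L → ℝ) (e' e₁ : ℝ),
        0 ≤ e' ∧ 0 ≤ e₁ ∧
        (∀ x y, ¬(x ∈ klBall L μ K₀ ∧ y ∈ klBall L μ K₀) → X x y = 0) ∧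
        (∀ x y, ¬(x ∈ klBall L μ K₀ ∧ y ∈ klBall L μ K₀) → Y x y = 0) ∧
        (∀ x y, 0 ≤ E' x y) ∧ (∀ x y, 0 ≤ Ea x y) ∧ (∀ x y, 0 ≤ E'' x y) ∧
        (1 - diagonal (fun p => (μ' p : ℂ)) * X) * N' = 1 ∧
        (∀ k ∈ klBall L μ K₀, ∀ k' ∈ klBall L μ K₀,
          ‖klPairAmplitude L M β U μ K₀ (n - 1) Qm k k' - (X * N') k k'‖ ≤ E' k k') ∧
        (∀ x y, E' x y ≤ e') ∧
        (1 + diagonal (fun p => (w₁ p : ℂ)) * X) * N = 1 ∧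
        (∀ k ∈ klBall L μ K₀, ∀ k' ∈ klBall L μ K₀, ‖Y k k' - (X * N) k k'‖ ≤ Ea k k') ∧
        (1 - diagonal (fun p => (μw p : ℂ)) * Y) * N'' = 1 ∧
        (∀ k ∈ klBall L μ K₀, ∀ k' ∈ klBall L μ K₀,
          ‖klPairAmplitude L M β U μ K₀ n Qm k k' - (Y * N'') k k'‖ ≤ E'' k k') ∧
        (∀ x y, Ea x y + (E' x y + 3 / 2 * m * ∑ b, E' x b * |w₁ b + μ' b| + 3 / 2 * (m + e') * ∑ a, |w₁ a + μ' a| * E' a y +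
            9 / 4 * (m + e') * m * ∑ a, ∑ b, |w₁ a + μ' a| * E' a b * |w₁ b + μ' b|) ≤ E₁ x y) ∧
        (∀ x y, E₁ x y ≤ e₁) ∧
        (m + e') * ∑ a, |w₁ a + μ' a| ≤ 1 / 3 ∧ (3 / 2 * m + e₁) * ∑ a, |μw a| ≤ 1 / 3 ∧
        (∑ p, |w₁ p + μ' p - μw p| ≤ G.bhi) ∧
        (∑ p, (|w₁ p + μ' p - μw p| - (w₁ p + μ' p - μw p)) ≤ 2 * klEdge G n (klTorusNorm L Qm)) ∧
        (∀ k ∈ klBall L μ K₀, ∀ k' ∈ klBall L μ K₀,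
          E'' k k' + (E₁ k k' + 3 / 2 * (3 / 2 * m) * ∑ b, E₁ k b * |μw b| + 3 / 2 * (3 / 2 * m + e₁) * ∑ a, |μw a| * E₁ a k' +
              9 / 4 * (3 / 2 * m + e₁) * (3 / 2 * m) * ∑ a, ∑ b, |μw a| * E₁ a b * |μw b|) ≤
            drivePBar G P U (n - 1) + eremBar G P Q U β L (n - 1) + thermalBar G P U β n +
              legDressBarQ G P Q U n (legSliceCountT L β μ K₀ n ![k', Qm - k', Qm - k, k]) +
              (P.Klam * U) ^ 2 * (G.phGain n (klTorusNorm L (k - k')) + G.phGain n (klTorusNorm L (k + k' - Qm))))) :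
    PairLadderStepAtV9 L M G P Q β U μ K₀ n := by
  refine ⟨fun h0 => absurd h0 (by omega), fun _ Qm hQm => ?_⟩
  obtain ⟨X, Y, N', N, N'', μ', w₁, μw, E', Ea, E'', E₁, e', e₁, he', he₁, hX0, hY0, hE'0, hEa0, hE''0, hN', hE', hE'e, hN, hEa,
    hN'', hE'', hE₁, hE₁e, hsm₁, hsm₂, hmass, hneg, hbud⟩ := htower Qm hQm
  set B := klBall L μ K₀ with hB_def
  set C₀ : Matrix (TorusSite 2 L) (TorusSite 2 L) ℂ := klPairArray L M β U μ K₀ (n - 1) Qm with hC₀_def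
  set C₁ : Matrix (TorusSite 2 L) (TorusSite 2 L) ℂ := klPairArray L M β U μ K₀ n Qm with hC₁_def
  -- the plain arrays on / off the ball
  have hC_on : ∀ j, ∀ k ∈ B, ∀ k' ∈ B, klPairArray L M β U μ K₀ j Qm k k' = klPairAmplitude L M β U μ K₀ j Qm k k' := by
    intro j k hk k' hk'
    simp only [klPairArray, Matrix.of_apply, hB_def] at hk hk' ⊢
    rw [if_pos ⟨hk, hk'⟩]
  have hC_off : ∀ j x y, ¬(x ∈ B ∧ y ∈ B) → klPairArray L M β U μ K₀ j Qm x y = 0 := by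
    intro j x y hxy
    simp only [klPairArray, Matrix.of_apply, hB_def] at hxy ⊢
    rw [if_neg hxy]
  -- vanishing of the resummed intermediate arrays off the ball
  have hN'alt : (1 + (-diagonal (fun p => (μ' p : ℂ))) * X) * N' = 1 := by
    rw [neg_mul, ← sub_eq_add_neg]; exact hN'
  have hN''alt : (1 + (-diagonal (fun p => (μw p : ℂ))) * Y) * N'' = 1 := by
    rw [neg_mul, ← sub_eq_add_neg]; exact hN''
  have hXN'0 : ∀ x y, ¬(x ∈ B ∧ y ∈ B) → (X * N') x y = 0 := fun x y hxy =>
    kltc_mul_rightInv_apply_eq_zero X _ N' B hN'alt hX0 hxy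
  have hXN0 : ∀ x y, ¬(x ∈ B ∧ y ∈ B) → (X * N) x y = 0 := fun x y hxy =>
    kltc_mul_rightInv_apply_eq_zero X _ N B hN hX0 hxy
  have hYN''0 : ∀ x y, ¬(x ∈ B ∧ y ∈ B) → (Y * N'') x y = 0 := fun x y hxy =>
    kltc_mul_rightInv_apply_eq_zero Y _ N'' B hN''alt hY0 hxy
  -- global error bounds
  have gE' : ∀ x y, ‖C₀ x y - (X * N') x y‖ ≤ E' x y := by
    intro x y
    by_cases hxy : x ∈ B ∧ y ∈ B
    · rw [hC₀_def, hC_on (n - 1) x hxy.1 y hxy.2]; exact hE' x hxy.1 y hxy.2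
    · rw [hC₀_def, hC_off (n - 1) x y hxy, hXN'0 x y hxy, sub_zero, norm_zero]; exact hE'0 x y
  have gEa : ∀ x y, ‖Y x y - (X * N) x y‖ ≤ Ea x y := by
    intro x y
    by_cases hxy : x ∈ B ∧ y ∈ B
    · exact hEa x hxy.1 y hxy.2
    · rw [hY0 x y hxy, hXN0 x y hxy, sub_zero, norm_zero]; exact hEa0 x y
  have gE'' : ∀ x y, ‖C₁ x y - (Y * N'') x y‖ ≤ E'' x y := by
    intro x y
    by_cases hxy : x ∈ B ∧ y ∈ B
    · rw [hC₁_def, hC_on n x hxy.1 y hxy.2]; exact hE'' x hxy.1 y hxy.2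
    · rw [hC₁_def, hC_off n x y hxy, hYN''0 x y hxy, sub_zero, norm_zero]; exact hE''0 x y
  -- norms of the real weights
  have hρ : ∀ a, ‖(w₁ a : ℂ) + (μ' a : ℂ)‖ ≤ |w₁ a + μ' a| := fun a => by
    rw [← Complex.ofReal_add, Complex.norm_real, Real.norm_eq_abs]
  have hσ : ∀ a, ‖(μw a : ℂ)‖ ≤ |μw a| := fun a => by rw [Complex.norm_real, Real.norm_eq_abs]
  obtain ⟨N₃, hN₃1, -, hbd⟩ := kltc_tower_compose C₀ C₁ X Y N' N N'' (fun p => (μ' p : ℂ)) (fun p => (w₁ p : ℂ))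
    (fun p => (μw p : ℂ)) (fun a => |w₁ a + μ' a|) (fun a => |μw a|) E' Ea E'' E₁ hm he' he₁ (hC₀ Qm) hρ hσ hN' gE' hE'e hN gEa
    hN'' gE'' hE₁ hE₁e hsm₁ hsm₂
  have hfun : (fun p => ((w₁ p + μ' p - μw p : ℝ) : ℂ)) = fun a => (w₁ a : ℂ) + (μ' a : ℂ) - (μw a : ℂ) := by
    funext p; push_cast; ring
  refine ⟨fun p => w₁ p + μ' p - μw p, hmass, hneg, N₃, ?_, fun k hk k' hk' => ?_⟩
  · rw [hfun]; exact hN₃1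
  · have h := hbd k k'
    rw [hC₁_def, hC_on n k hk k' hk'] at h
    exact h.trans (hbud k hk k' hk')

end Model

end Summit.HubbardSuperconductivity.HubbardSuperconductivity.Theorems.KLRegimeSplit

end
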